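import Literature.Analysis.FluidPDE.NSFourierRestart
import Literature.Analysis.FluidPDE.NSEnstrophyPersistence
import HarnessLib

/-!
# Sobolev norms of the Fourier–Picard solution: the Plancherel dictionary for word derivatives

For the classical solution `u = Re 𝓕 v` synthesized from a `FourierDatum` (`NSFourierRestart`;
the tree's Fourier-side Picard construction of Leray's local regular solution, Leray 1934, §19)
this file computes every coordinate word derivative on the Fourier side,

  `∂^α uᵢ(t) = Re 𝓕 (dsym α · vᵢ(t))`,  `dsym α ξ = ∏ⱼ (−2πi ξ_{α j})`  (`FourierDatum.ipderiv_u_eq`),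

(induction on the word, one letter at a time through the tree's dictionary
`fderiv_fourier_apply'`: `∂_h 𝓕 g = 𝓕(−2πi⟪ξ,h⟫ g)`), and draws the consequences used by the
continuation arguments:

* **Plancherel identity for the coordinate tensors** (`FourierDatum.lintegral_levelSq_u_eq`):
  `∫ |∇ᵐu(t)|² dx = (2π)^{2m} ∫ ‖ξ‖^{2m} ∑ₗ |vₗ(t,ξ)|² dξ` (the syntheses are real by the
  conjugation symmetry, `∑_α ∏ⱼ ξ²_{α j} = ‖ξ‖^{2m}`);
* **all Sobolev norms are bounded** (`FourierDatum.lintegral_levelSq_u_le`,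
  `FourierDatum.hasBoundedSobolevNormsOn_u` on `ℝ³`): the solution is *strong*,
  `u ∈ L^∞_t H^k_x` for every `k`, with bounds from the uniform polynomial decay of `v`
  (`∫ |∇ᵐu|² ≤ card ι^{m+1} (2π)^{2m} B²_{K₀+m} I_{K₀}`) and the comparison
  `‖Dᵐu‖² ≤ 3^{m+1}|∇ᵐu|²` of `NSEnstrophyPersistence`.

## References

* J. Leray, Acta Math. 63 (1934), §19, and (1.17)–(1.19) (Plancherel for the regular
  solution). [Leray1934]
* W. S. Ożański, B. C. Pooley, LMS LN 452, CUP 2018, Cor. 6.16 (all derivatives of the local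
  strong solution lie in `L²`). [OzanskiPooley2018]
-/

noncomputable section

open MeasureTheory Real Set Filter Topology Function Complex FourierTransform VectorFourier
  InnerProductSpace
open scoped FourierTransform RealInnerProductSpace ENNReal ContDiff ComplexConjugate

namespace Literature.Analysis.FluidPDE.FourierNS

variable {ι : Type*} [Fintype ι] [DecidableEq ι]

/-! ### The symbol of a word derivative -/

/-- The Fourier symbol of the word derivative `∂^α`, `α : Fin m → ι`:
`dsym α ξ = ∏ⱼ (−2πi ξ_{α j})`. [folklore] -/
def dsym {m : ℕ} (α : Fin m → ι) (ξ : EuclideanSpace ℝ ι) : ℂ :=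
  ∏ j, (-(2 * π * I) * ((ξ (α j) : ℝ) : ℂ))

omit [Fintype ι] [DecidableEq ι] in
/-- The empty word has symbol `1`. [folklore] -/
@[simp]
theorem dsym_zero (α : Fin 0 → ι) (ξ : EuclideanSpace ℝ ι) : dsym α ξ = 1 := by
  simp [dsym]

omit [Fintype ι] [DecidableEq ι] in
/-- One more letter: `dsym α = (−2πi ξ_{α 0}) · dsym (tail α)`. [folklore] -/
theorem dsym_succ {m : ℕ} (α : Fin (m + 1) → ι) (ξ : EuclideanSpace ℝ ι) :
    dsym α ξ = (-(2 * π * I) * ((ξ (α 0) : ℝ) : ℂ)) * dsym (Fin.tail α) ξ :=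
  Fin.prod_univ_succ _

omit [Fintype ι] [DecidableEq ι] in
/-- `‖−2πi ξₗ‖ = 2π |ξₗ|`. [folklore] -/
theorem norm_letter (ξ : EuclideanSpace ℝ ι) (l : ι) :
    ‖-(2 * π * I) * ((ξ l : ℝ) : ℂ)‖ = 2 * π * |ξ l| := by
  rw [norm_mul, norm_neg, norm_mul, norm_mul, Complex.norm_two, Complex.norm_real,
    Complex.norm_I, mul_one, Real.norm_eq_abs, abs_of_pos Real.pi_pos, Complex.norm_real,
    Real.norm_eq_abs]

omit [DecidableEq ι] in
/-- `‖−2πi ξₗ‖ ≤ 2π ‖ξ‖`. [folklore] -/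
theorem norm_letter_le (ξ : EuclideanSpace ℝ ι) (l : ι) :
    ‖-(2 * π * I) * ((ξ l : ℝ) : ℂ)‖ ≤ 2 * π * ‖ξ‖ := by
  rw [norm_letter]
  exact mul_le_mul_of_nonneg_left (abs_apply_le_norm ξ l) (by positivity)

omit [DecidableEq ι] in
/-- `‖dsym α ξ‖ ≤ (2π‖ξ‖)^m`. [folklore] -/
theorem norm_dsym_le {m : ℕ} (α : Fin m → ι) (ξ : EuclideanSpace ℝ ι) :
    ‖dsym α ξ‖ ≤ (2 * π * ‖ξ‖) ^ m := by
  unfold dsym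
  rw [norm_prod]
  calc ∏ j, ‖-(2 * π * I) * ((ξ (α j) : ℝ) : ℂ)‖ ≤ ∏ _j : Fin m, (2 * π * ‖ξ‖) :=
        Finset.prod_le_prod (fun j _ => norm_nonneg _) fun j _ => norm_letter_le ξ (α j)
    _ = (2 * π * ‖ξ‖) ^ m := by simp

omit [DecidableEq ι] in
/-- Polynomial growth of the symbol: `‖dsym α ξ‖ ≤ (2π)^m (1 + ‖ξ‖)^m`. [folklore] -/
theorem norm_dsym_le_growth {m : ℕ} (α : Fin m → ι) (ξ : EuclideanSpace ℝ ι) :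
    ‖dsym α ξ‖ ≤ (2 * π) ^ m * (1 + ‖ξ‖) ^ m := by
  refine (norm_dsym_le α ξ).trans ?_
  rw [mul_pow]
  gcongr
  linarith [norm_nonneg ξ]

omit [Fintype ι] [DecidableEq ι] in
/-- The squared modulus of the symbol: `‖dsym α ξ‖² = ∏ⱼ (2π)² ξ²_{α j}`. [folklore] -/
theorem norm_dsym_sq {m : ℕ} (α : Fin m → ι) (ξ : EuclideanSpace ℝ ι) :
    ‖dsym α ξ‖ ^ 2 = ∏ j, (2 * π) ^ 2 * ξ (α j) ^ 2 := by
  unfold dsym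
  rw [norm_prod, ← Finset.prod_pow]
  refine Finset.prod_congr rfl fun j _ => ?_
  rw [norm_letter, mul_pow, sq_abs]

omit [DecidableEq ι] in
/-- **`∑_α ‖dsym α ξ‖² = (2π)^{2m} ‖ξ‖^{2m}`** (expand `(∑ₗ ξₗ²)^m`). [folklore] -/
theorem sum_norm_dsym_sq (m : ℕ) (ξ : EuclideanSpace ℝ ι) :
    ∑ α : Fin m → ι, ‖dsym α ξ‖ ^ 2 = (2 * π) ^ (2 * m) * ‖ξ‖ ^ (2 * m) := by
  classical
  simp_rw [norm_dsym_sq]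
  rw [← Fintype.piFinset_univ, ← Finset.prod_univ_sum (fun _ : Fin m => (Finset.univ : Finset ι))
    (fun _ l => (2 * π) ^ 2 * ξ l ^ 2)]
  rw [Finset.prod_const, Finset.card_univ, Fintype.card_fin, ← Finset.mul_sum, mul_pow, ← pow_mul,
    pow_mul ‖ξ‖ 2 m, EuclideanSpace.real_norm_sq_eq]

omit [Fintype ι] [DecidableEq ι] in
/-- Conjugation symmetry of the symbol: `dsym α (−ξ) = conj (dsym α ξ)`. [folklore] -/
theorem dsym_neg {m : ℕ} (α : Fin m → ι) (ξ : EuclideanSpace ℝ ι) :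
    dsym α (-ξ) = conj (dsym α ξ) := by
  unfold dsym
  rw [map_prod]
  refine Finset.prod_congr rfl fun j _ => ?_
  simp only [PiLp.neg_apply, Complex.ofReal_neg, map_mul, map_neg, Complex.conj_ofReal,
    Complex.conj_I, map_ofNat]
  ring

omit [Fintype ι] [DecidableEq ι] in
/-- The symbol is continuous. [folklore] -/
theorem continuous_dsym {m : ℕ} (α : Fin m → ι) : Continuous (dsym (ι := ι) α) := by
  unfold dsym
  fun_prop

omit [DecidableEq ι] in
/-- Multiplication by the symbol of a word of length `m` costs `m` orders of decay. [folklore] -/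
theorem HasDecay.dsym_mul {K m : ℕ} {C : ℝ} {f : EuclideanSpace ℝ ι → ℂ}
    (h : HasDecay (K + m) C f) (α : Fin m → ι) :
    HasDecay K ((2 * π) ^ m * C) (fun ξ => dsym α ξ * f ξ) :=
  h.mul_growth (by positivity) (norm_dsym_le_growth α)

/-! ### One letter: the coordinate derivative of the real part of a synthesis -/

/-- `⟪ξ, eₗ⟫ = ξₗ`. [folklore] -/
theorem inner_stdVec_right (ξ : EuclideanSpace ℝ ι) (l : ι) : ⟪ξ, (stdVec l : EuclideanSpace ℝ ι)⟫ = ξ l := by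
  rw [stdVec, EuclideanSpace.inner_single_right]
  simp

/-- **One letter of the dictionary**: `∂ₗ Re 𝓕 g = Re 𝓕 (−2πi ξₗ g)` for a symbol `g` with
decay of order `1 + K₀`. [folklore] -/
theorem pderiv_re_fourier {K₀ : ℕ} {C : ℝ} {g : EuclideanSpace ℝ ι → ℂ}
    (hK₀ : Fintype.card ι < K₀) (hg : HasDecay (1 + K₀) C g)
    (hgm : AEStronglyMeasurable g volume) (l : ι) :
    pderiv l (fun x => (𝓕 g x).re) =
      fun x => (𝓕 (fun ξ => (-(2 * π * I) * ((ξ l : ℝ) : ℂ)) * g ξ) x).re := by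
  funext x
  rw [pderiv_apply]
  have hd : DifferentiableAt ℝ (𝓕 g) x := (differentiable_fourier' hK₀ hg hgm) x
  have h1 : fderiv ℝ (fun y => (𝓕 g y).re) x = Complex.reCLM.comp (fderiv ℝ (𝓕 g) x) :=
    (Complex.reCLM.hasFDerivAt.comp x hd.hasFDerivAt).fderiv
  rw [h1, ContinuousLinearMap.comp_apply, Complex.reCLM_apply, fderiv_fourier_apply' hK₀ hg hgm]
  congr 2
  refine congrFun (fourier_congr' fun ξ => ?_) x
  rw [inner_stdVec_right]

/-! ### The synthesized velocity of a coefficient field -/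

/-- **The synthesized velocity** of a Fourier coefficient field `V₀ : E → ℂ^ι`:
`synthVel V₀ x = Re 𝓕 V₀(x)` componentwise (so that `ClayDatum.u t = synthVel (v t)` and
`FourierDatum.u t = synthVel (v t)` definitionally). [folklore] -/
def synthVel (V₀ : EuclideanSpace ℝ ι → ι → ℂ) (x : EuclideanSpace ℝ ι) : EuclideanSpace ℝ ι :=
  ClayDatum.reVec fun l => 𝓕 (fun ξ => V₀ ξ l) x

omit [DecidableEq ι] in
/-- Components of the synthesized velocity. [folklore] -/
@[simp]
theorem synthVel_apply (V₀ : EuclideanSpace ℝ ι → ι → ℂ) (x : EuclideanSpace ℝ ι) (l : ι) :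
    synthVel V₀ x l = (𝓕 (fun ξ => V₀ ξ l) x).re := rfl

/-- The velocity of a `FourierDatum` solution is the synthesis of `v t` (definitional). [folklore] -/
theorem FourierDatum.u_eq_synthVel (d : FourierDatum ι) (t : ℝ) : d.u t = synthVel (d.v t) := rfl

/-- The velocity of a `ClayDatum` solution is the synthesis of `v t` (definitional). [folklore] -/
theorem ClayDatum.u_eq_synthVel (d : ClayDatum ι) (t : ℝ) : d.u t = synthVel (d.v t) := rfl

section SynthVel

variable (V₀ : EuclideanSpace ℝ ι → ι → ℂ)

omit [Fintype ι] [DecidableEq ι] in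
/-- The symbol-weighted components `dsym α · V₀ᵢ` are continuous. [folklore] -/
theorem continuous_dsym_mul {m : ℕ} (hc : Continuous V₀) (α : Fin m → ι) (i : ι) :
    Continuous fun ξ => dsym α ξ * V₀ ξ i :=
  (continuous_dsym α).mul ((continuous_apply i).comp hc)

omit [DecidableEq ι] in
/-- Components of the synthesized velocity are `Cⁿ` for every `n`. [folklore] -/
theorem contDiff_synthVel_apply (hc : Continuous V₀) (hdec : ∀ K : ℕ, ∃ B, HasDecay K B V₀)
    (i : ι) : ContDiff ℝ ∞ fun y => synthVel V₀ y i := by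
  refine contDiff_infty.2 fun n => ?_
  obtain ⟨B, hB⟩ := hdec (n + (Fintype.card ι + 1))
  have h := contDiff_fourier' (n := n) (Nat.lt_succ_self _) (hB.apply i)
    (((continuous_apply i).comp hc).aestronglyMeasurable)
  exact Complex.reCLM.contDiff.comp h

omit [DecidableEq ι] in
/-- The synthesized velocity is smooth. [folklore] -/
theorem contDiff_synthVel (hc : Continuous V₀) (hdec : ∀ K : ℕ, ∃ B, HasDecay K B V₀) :
    ContDiff ℝ ∞ (synthVel V₀) :=
  contDiff_euclidean.2 fun i => contDiff_synthVel_apply V₀ hc hdec i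

/-- **Word derivatives on the Fourier side**: `∂^α (synthVel V₀)ᵢ = Re 𝓕 (dsym α · V₀ᵢ)` for
every word `α` (induction on the word through `pderiv_re_fourier`). [folklore] -/
theorem ipderiv_synthVel_eq (hc : Continuous V₀) (hdec : ∀ K : ℕ, ∃ B, HasDecay K B V₀) (i : ι) :
    ∀ {m : ℕ} (α : Fin m → ι),
      ipderiv α (fun y => synthVel V₀ y i) = fun x => (𝓕 (fun ξ => dsym α ξ * V₀ ξ i) x).re
  | 0, α => by
      funext x
      simp
  | m + 1, α => by
      rw [ipderiv_succ, ipderiv_synthVel_eq hc hdec i (Fin.tail α)]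
      obtain ⟨B, hB⟩ := hdec (1 + (Fintype.card ι + 1) + m)
      have hg : HasDecay (1 + (Fintype.card ι + 1)) ((2 * π) ^ m * B)
          (fun ξ => dsym (Fin.tail α) ξ * V₀ ξ i) := (hB.apply i).dsym_mul (Fin.tail α)
      rw [pderiv_re_fourier (Nat.lt_succ_self _) hg
        ((continuous_dsym_mul V₀ hc _ i).aestronglyMeasurable) (α 0)]
      funext x
      congr 2
      refine congrFun (fourier_congr' fun ξ => ?_) x
      rw [dsym_succ]
      ring

omit [DecidableEq ι] in
/-- The syntheses `𝓕 (dsym α · V₀ᵢ)` are real when `V₀` is conjugation symmetric. [folklore] -/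
theorem fourier_dsym_mul_real (hconj : ∀ ξ l, V₀ (-ξ) l = conj (V₀ ξ l)) {m : ℕ} (α : Fin m → ι)
    (i : ι) (x : EuclideanSpace ℝ ι) :
    𝓕 (fun ξ => dsym α ξ * V₀ ξ i) x = (((𝓕 (fun ξ => dsym α ξ * V₀ ξ i) x).re : ℝ) : ℂ) :=
  fourier_eq_re_of_conj_symm (fun ξ => by rw [dsym_neg, hconj, map_mul]) x

omit [DecidableEq ι] [Fintype ι] in
/-- `ofReal (Re z)² ≤ ‖z‖ₑ²`. [folklore] -/
theorem ofReal_re_sq_le (z : ℂ) : ENNReal.ofReal (z.re ^ 2) ≤ ‖z‖ₑ ^ 2 := by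
  rw [← ofReal_norm, ← ENNReal.ofReal_pow (norm_nonneg _)]
  refine ENNReal.ofReal_le_ofReal ?_
  rw [← sq_abs]
  exact pow_le_pow_left₀ (abs_nonneg _) (Complex.abs_re_le_norm z) 2

/-- **Plancherel bound for one word derivative**: if `V₀` has decay of order
`card ι + 1 + m` with constant `B`, then `∫ (∂^α (synthVel V₀)ᵢ)² ≤ ((2π)^m B)² I_{card ι + 1}`. [folklore] -/
theorem lintegral_ipderiv_synthVel_sq_le (hc : Continuous V₀) (hdec : ∀ K : ℕ, ∃ B, HasDecay K B V₀)
    {m : ℕ} (α : Fin m → ι) (i : ι) {B : ℝ} (hB : HasDecay (Fintype.card ι + 1 + m) B V₀) :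
    ∫⁻ x, ENNReal.ofReal (ipderiv α (fun y => synthVel V₀ y i) x ^ 2) ≤
      ENNReal.ofReal (((2 * π) ^ m * B) ^ 2 *
        weightMass (EuclideanSpace ℝ ι) (Fintype.card ι + 1)) := by
  rw [ipderiv_synthVel_eq V₀ hc hdec i α]
  have hg := (hB.apply i).dsym_mul α
  calc ∫⁻ x, ENNReal.ofReal ((𝓕 (fun ξ => dsym α ξ * V₀ ξ i) x).re ^ 2)
      ≤ ∫⁻ x, ‖𝓕 (fun ξ => dsym α ξ * V₀ ξ i) x‖ₑ ^ 2 := lintegral_mono fun x => ofReal_re_sq_le _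
    _ ≤ _ := lintegral_sq_fourier_le (Nat.lt_succ_self _) hg
        ((continuous_dsym_mul V₀ hc α i).aestronglyMeasurable)

/-- **Plancherel identity for one word derivative** (conjugation-symmetric `V₀`):
`∫ (∂^α (synthVel V₀)ᵢ)² dx = ∫ ‖dsym α ξ · V₀ᵢ(ξ)‖² dξ`. [folklore] -/
theorem lintegral_ipderiv_synthVel_sq_eq (hc : Continuous V₀)
    (hdec : ∀ K : ℕ, ∃ B, HasDecay K B V₀) (hconj : ∀ ξ l, V₀ (-ξ) l = conj (V₀ ξ l))
    {m : ℕ} (α : Fin m → ι) (i : ι) :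
    ∫⁻ x, ENNReal.ofReal (ipderiv α (fun y => synthVel V₀ y i) x ^ 2) =
      ∫⁻ ξ, ‖dsym α ξ * V₀ ξ i‖ₑ ^ 2 := by
  rw [ipderiv_synthVel_eq V₀ hc hdec i α]
  obtain ⟨B, hB⟩ := hdec (Fintype.card ι + 1 + m)
  have hg := (hB.apply i).dsym_mul α
  have hgm : AEStronglyMeasurable (fun ξ => dsym α ξ * V₀ ξ i) volume :=
    (continuous_dsym_mul V₀ hc α i).aestronglyMeasurable
  have hint : Integrable (fun ξ => dsym α ξ * V₀ ξ i) :=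
    hg.integrable (finrank_lt_of_card_lt (Nat.lt_succ_self _)) hgm
  rw [← lintegral_sq_fourier_eq hint (memLp_two_of_hasDecay (Nat.lt_succ_self _) hg hgm)]
  refine lintegral_congr fun x => ?_
  rw [← ofReal_norm, ← ENNReal.ofReal_pow (norm_nonneg _)]
  congr 1
  conv_rhs => rw [fourier_dsym_mul_real V₀ hconj α i x, Complex.norm_real, Real.norm_eq_abs,
    sq_abs]

/-- Unfolding `levelSq` under `∫⁻ ofReal`: a double finite sum of the word integrals. [folklore] -/
theorem lintegral_levelSq_synthVel_eq_sum (hc : Continuous V₀)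
    (hdec : ∀ K : ℕ, ∃ B, HasDecay K B V₀) (m : ℕ) :
    ∫⁻ x, ENNReal.ofReal (levelSq m (synthVel V₀) x) =
      ∑ i, ∑ α : Fin m → ι, ∫⁻ x, ENNReal.ofReal (ipderiv α (fun y => synthVel V₀ y i) x ^ 2) := by
  have hmeas : ∀ (i : ι) (α : Fin m → ι),
      Measurable fun x => ENNReal.ofReal (ipderiv α (fun y => synthVel V₀ y i) x ^ 2) :=
    fun i α => ((contDiff_ipderiv (contDiff_synthVel_apply V₀ hc hdec i) α).continuous.pow
      2).measurable.ennreal_ofReal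
  calc ∫⁻ x, ENNReal.ofReal (levelSq m (synthVel V₀) x)
      = ∫⁻ x, ∑ i, ∑ α : Fin m → ι,
          ENNReal.ofReal (ipderiv α (fun y => synthVel V₀ y i) x ^ 2) := by
        refine lintegral_congr fun x => ?_
        unfold levelSq dnormSq
        rw [ENNReal.ofReal_sum_of_nonneg fun i _ => Finset.sum_nonneg fun α _ => sq_nonneg _]
        exact Finset.sum_congr rfl fun i _ => ENNReal.ofReal_sum_of_nonneg fun α _ => sq_nonneg _
    _ = ∑ i, ∫⁻ x, ∑ α : Fin m → ι,
          ENNReal.ofReal (ipderiv α (fun y => synthVel V₀ y i) x ^ 2) :=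
        lintegral_finsetSum _ fun i _ => Finset.measurable_fun_sum _ fun α _ => hmeas i α
    _ = _ := Finset.sum_congr rfl fun i _ => lintegral_finsetSum _ fun α _ => hmeas i α

/-- **All coordinate tensors of the synthesis are square integrable**, with an explicit bound
from the decay of order `card ι + 1 + m`:
`∫ |∇ᵐ synthVel V₀|² ≤ card ι · card ι^m · ((2π)^m B)² I_{card ι+1}`. [folklore] -/
theorem lintegral_levelSq_synthVel_le (hc : Continuous V₀) (hdec : ∀ K : ℕ, ∃ B, HasDecay K B V₀)
    (m : ℕ) {B : ℝ} (hB : HasDecay (Fintype.card ι + 1 + m) B V₀) :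
    ∫⁻ x, ENNReal.ofReal (levelSq m (synthVel V₀) x) ≤
      Fintype.card ι * (Fintype.card (Fin m → ι) * ENNReal.ofReal (((2 * π) ^ m * B) ^ 2 *
        weightMass (EuclideanSpace ℝ ι) (Fintype.card ι + 1))) := by
  rw [lintegral_levelSq_synthVel_eq_sum V₀ hc hdec m]
  calc ∑ i, ∑ α : Fin m → ι, ∫⁻ x, ENNReal.ofReal (ipderiv α (fun y => synthVel V₀ y i) x ^ 2)
      ≤ ∑ _i : ι, ∑ _α : Fin m → ι, ENNReal.ofReal (((2 * π) ^ m * B) ^ 2 *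
          weightMass (EuclideanSpace ℝ ι) (Fintype.card ι + 1)) :=
        Finset.sum_le_sum fun i _ => Finset.sum_le_sum fun α _ =>
          lintegral_ipderiv_synthVel_sq_le V₀ hc hdec α i hB
    _ = _ := by
        rw [Finset.sum_const, Finset.card_univ, nsmul_eq_mul, Finset.sum_const, Finset.card_univ,
          nsmul_eq_mul]

/-- **Plancherel identity for the coordinate tensors** (conjugation-symmetric `V₀`):
`∫ |∇ᵐ synthVel V₀|² dx = (2π)^{2m} ∫ ‖ξ‖^{2m} ∑ₗ ‖V₀ₗ(ξ)‖² dξ`. [folklore] -/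
theorem lintegral_levelSq_synthVel_eq (hc : Continuous V₀) (hdec : ∀ K : ℕ, ∃ B, HasDecay K B V₀)
    (hconj : ∀ ξ l, V₀ (-ξ) l = conj (V₀ ξ l)) (m : ℕ) :
    ∫⁻ x, ENNReal.ofReal (levelSq m (synthVel V₀) x) =
      ENNReal.ofReal ((2 * π) ^ (2 * m)) *
        ∫⁻ ξ, ENNReal.ofReal (‖ξ‖ ^ (2 * m)) * ∑ l, ‖V₀ ξ l‖ₑ ^ 2 := by
  rw [lintegral_levelSq_synthVel_eq_sum V₀ hc hdec m]
  simp_rw [lintegral_ipderiv_synthVel_sq_eq V₀ hc hdec hconj]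
  have hmeas : ∀ (i : ι) (α : Fin m → ι),
      AEMeasurable (fun ξ => ‖dsym α ξ * V₀ ξ i‖ₑ ^ 2) volume := fun i α =>
    ((continuous_dsym_mul V₀ hc α i).measurable.enorm.pow_const 2).aemeasurable
  rw [Finset.sum_comm]
  calc ∑ α : Fin m → ι, ∑ i, ∫⁻ ξ, ‖dsym α ξ * V₀ ξ i‖ₑ ^ 2
      = ∫⁻ ξ, ∑ α : Fin m → ι, ∑ i, ‖dsym α ξ * V₀ ξ i‖ₑ ^ 2 := by
        rw [lintegral_finsetSum' _ fun α _ => Finset.aemeasurable_fun_sum _ fun i _ => hmeas i α]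
        exact Finset.sum_congr rfl fun α _ => (lintegral_finsetSum' _ fun i _ => hmeas i α).symm
    _ = ∫⁻ ξ, ENNReal.ofReal ((2 * π) ^ (2 * m)) *
          (ENNReal.ofReal (‖ξ‖ ^ (2 * m)) * ∑ l, ‖V₀ ξ l‖ₑ ^ 2) := by
        refine lintegral_congr fun ξ => ?_
        have h1 : ∀ (α : Fin m → ι) (i : ι), ‖dsym α ξ * V₀ ξ i‖ₑ ^ 2 =
            ENNReal.ofReal (‖dsym α ξ‖ ^ 2) * ‖V₀ ξ i‖ₑ ^ 2 := fun α i => by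
          rw [enorm_mul, mul_pow, ← ofReal_norm (dsym α ξ), ENNReal.ofReal_pow (norm_nonneg _)]
        simp_rw [h1, ← Finset.mul_sum, ← Finset.sum_mul]
        rw [← ENNReal.ofReal_sum_of_nonneg fun α _ => sq_nonneg _, sum_norm_dsym_sq,
          ENNReal.ofReal_mul (by positivity), mul_assoc]
    _ = _ := lintegral_const_mul' _ _ ENNReal.ofReal_ne_top

/-- **Energy identity** (`m = 0`): `∫ ‖synthVel V₀‖² dx = ∫ ∑ₗ ‖V₀ₗ(ξ)‖² dξ`. [folklore] -/
theorem lintegral_norm_synthVel_sq_eq (hc : Continuous V₀) (hdec : ∀ K : ℕ, ∃ B, HasDecay K B V₀)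
    (hconj : ∀ ξ l, V₀ (-ξ) l = conj (V₀ ξ l)) :
    ∫⁻ x, ‖synthVel V₀ x‖ₑ ^ 2 = ∫⁻ ξ, ∑ l, ‖V₀ ξ l‖ₑ ^ 2 := by
  have h := lintegral_levelSq_synthVel_eq V₀ hc hdec hconj 0
  simp only [mul_zero, pow_zero, ENNReal.ofReal_one, one_mul] at h
  rw [← h]
  refine lintegral_congr fun x => ?_
  rw [levelSq_zero_eq_norm_sq, ← ofReal_norm, ENNReal.ofReal_pow (norm_nonneg _)]

omit [DecidableEq ι] in
/-- The sup norm on `ℂ^ι` is dominated by the `ℓ²` sum: `‖z‖² ≤ ∑ₗ ‖zₗ‖²`. [folklore] -/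
theorem norm_sq_le_sum_norm_sq (z : ι → ℂ) : ‖z‖ ^ 2 ≤ ∑ l, ‖z l‖ ^ 2 := by
  have hS : 0 ≤ ∑ l, ‖z l‖ ^ 2 := Finset.sum_nonneg fun l _ => sq_nonneg _
  have h : ‖z‖ ≤ Real.sqrt (∑ l, ‖z l‖ ^ 2) := by
    refine (pi_norm_le_iff_of_nonneg (Real.sqrt_nonneg _)).2 fun l => ?_
    rw [← Real.sqrt_sq (norm_nonneg (z l))]
    exact Real.sqrt_le_sqrt (Finset.single_le_sum (f := fun l => ‖z l‖ ^ 2)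
      (fun l _ => sq_nonneg _) (Finset.mem_univ l))
  calc ‖z‖ ^ 2 ≤ Real.sqrt (∑ l, ‖z l‖ ^ 2) ^ 2 := pow_le_pow_left₀ (norm_nonneg _) h 2
    _ = ∑ l, ‖z l‖ ^ 2 := Real.sq_sqrt hS

omit [DecidableEq ι] in
/-- `ℝ≥0∞` form: `‖z‖ₑ² ≤ ∑ₗ ‖zₗ‖ₑ²`. [folklore] -/
theorem enorm_sq_le_sum_enorm_sq (z : ι → ℂ) : ‖z‖ₑ ^ 2 ≤ ∑ l, ‖z l‖ₑ ^ 2 := by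
  have h1 : ∀ w : ℂ, ‖w‖ₑ ^ 2 = ENNReal.ofReal (‖w‖ ^ 2) := fun w => by
    rw [← ofReal_norm, ENNReal.ofReal_pow (norm_nonneg _)]
  rw [← ofReal_norm, ← ENNReal.ofReal_pow (norm_nonneg _)]
  simp_rw [h1]
  rw [← ENNReal.ofReal_sum_of_nonneg fun l _ => sq_nonneg _]
  exact ENNReal.ofReal_le_ofReal (norm_sq_le_sum_norm_sq z)

end SynthVel

/-! ### The solution of a `FourierDatum` is strong (`ℝ³`) -/

namespace FourierDatum

/-- Time slices of the velocity are smooth (all `t`). [folklore] -/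
theorem contDiff_u (d : FourierDatum ι) (t : ℝ) : ContDiff ℝ ∞ (d.u t) := by
  rw [d.u_eq_synthVel]
  obtain h := d.decay_v_all
  exact contDiff_synthVel (d.v t) (d.continuous_v_slice t) fun K => by
    obtain ⟨B, hB⟩ := h K
    exact ⟨B, hB t⟩

/-- **The Fourier–Picard solution is strong**: on `ℝ³`, all Sobolev norms of `u` are bounded,
uniformly in time (`u ∈ L^∞_t H^k_x` for every `k`; Ożański–Pooley 2018, Cor. 6.16), from the
uniform polynomial decay of `v` and `‖Dᵐu‖² ≤ 3^{m+1}|∇ᵐu|²`. [folklore] -/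
theorem hasBoundedSobolevNormsOn_u (d : FourierDatum (Fin 3)) (S : Set ℝ) :
    HasBoundedSobolevNormsOn S d.u := by
  intro n
  have hdecT : ∀ t (K : ℕ), ∃ B, HasDecay K B (d.v t) := fun t K => by
    obtain ⟨B, hB⟩ := d.decay_v_all K
    exact ⟨B, hB t⟩
  obtain ⟨B, hB⟩ := d.decay_v_all (Fintype.card (Fin 3) + 1 + n)
  set C : ℝ≥0∞ := Fintype.card (Fin 3) * (Fintype.card (Fin n → Fin 3) *
    ENNReal.ofReal (((2 * π) ^ n * B) ^ 2 *
      weightMass (EuclideanSpace ℝ (Fin 3)) (Fintype.card (Fin 3) + 1))) with hCdef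
  have hC : C < ⊤ := ENNReal.mul_lt_top (ENNReal.natCast_lt_top _)
    (ENNReal.mul_lt_top (ENNReal.natCast_lt_top _) ENNReal.ofReal_lt_top)
  refine ⟨(ENNReal.ofReal (3 ^ (n + 1)) * C).toNNReal, fun t _ => ?_⟩
  rw [ENNReal.coe_toNNReal (ENNReal.mul_lt_top ENNReal.ofReal_lt_top hC).ne]
  have hv := d.contDiff_u t
  calc ∫⁻ x, ‖iteratedFDeriv ℝ n (d.u t) x‖ₑ ^ 2
      ≤ ∫⁻ x, ENNReal.ofReal (3 ^ (n + 1) * levelSq n (d.u t) x) := by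
        refine lintegral_mono fun x => ?_
        rw [← ofReal_norm, ← ENNReal.ofReal_pow (norm_nonneg _)]
        exact ENNReal.ofReal_le_ofReal (sq_norm_iteratedFDeriv_le_pow_mul_levelSq hv n x)
    _ = ENNReal.ofReal (3 ^ (n + 1)) * ∫⁻ x, ENNReal.ofReal (levelSq n (d.u t) x) := by
        rw [← lintegral_const_mul' _ _ ENNReal.ofReal_ne_top]
        refine lintegral_congr fun x => ?_
        rw [ENNReal.ofReal_mul (by positivity)]
    _ ≤ ENNReal.ofReal (3 ^ (n + 1)) * C := by
        refine mul_le_mul_right ?_ _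
        rw [d.u_eq_synthVel]
        exact lintegral_levelSq_synthVel_le (d.v t) (d.continuous_v_slice t) (hdecT t) n (hB t)

end FourierDatum

end Literature.Analysis.FluidPDE.FourierNS

end
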